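import Mathlib
import Summits.Ventures.PercRepro0.Defs
import Summits.Ventures.PercRepro0.PlanarGlue

/-!
# T2 · PLANAR-ASSEMBLY, Lean twin (seat p4)

Instantiates the abstract assembly `Summit.Ventures.PercRepro0.Planar.pc_eq_half_and_theta_pc_eq_zero`
(PlanarGlue.lean) on the cell's definitions (Defs.lean): the route's `T2_Planar` follows from the
paper-proved inputs L1 (monotonicity of `θ_2`), `θ_2(1) > 0`, P1 HARRIS, P5 SHARPNESS and the crossing
bound of T2-assembly-p4 §4 Step 2, each taken as an explicit hypothesis. No definitions (the point `½ ∈ [0,1]`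
is Defs' `clamp (1/2)`); no axioms beyond the standard three.
-/

namespace Summit.Ventures.PercRepro0.PlanarT2

open Summit.Ventures.PercRepro0.Defs Summit.Ventures.PercRepro0.Planar Set

/-- `½ ∈ [0,1]` as the clamp of the real `1/2` (Defs' `clamp`; no new definition). -/
theorem coe_clamp_half : ((clamp (1 / 2) : unitInterval) : ℝ) = 1 / 2 := by
  have hmem : (1 / 2 : ℝ) ∈ Set.Icc (0 : ℝ) 1 := by constructor <;> norm_num
  unfold clamp
  rw [Set.projIcc_of_mem _ hmem]

/-- **Lean twin of T2-assembly-p4 Theorem T2.** Inputs, each a paper-proved statement of the cell: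
`hmono` = the conclusion of L1 for `θ_2` (L1_Monotone specialised to `{0 ↔ ∞}`, GLUE L1);
`hone` = `θ_2(1) > 0` (GLUE L4 / Defs lemma `thetaI_one`); `hP1` = P1 HARRIS `θ_2(½) = 0`;
`hP5` = P5 SHARPNESS (SHARP-p4 Corollary S1′); `hcross` = the crossing bound `½ ≤ (n+1)·P_½(0 ↔ ∂Λ_{n+1})`
of T2-assembly §4 Step 2 (P6(a) Theorem 4.4 + Lemma 2.2 + F2 + the union bound), with `P_½ = P 2 (clamp (1/2))`.
Conclusion: `T2_Planar`, i.e. `θ_2(p_c(2)) = 0 ∧ p_c(2) = ½`. -/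
theorem T2_Planar_of (hmono : MonotoneOn (theta 2) (Icc 0 1)) (hone : 0 < theta 2 1)
    (hP1 : P1_Harris) (hP5 : P5_Sharpness 2)
    (hcross : ∀ n : ℕ, 1 ≤ n →
      (1 : ℝ) / 2 ≤ ((n : ℝ) + 1) * (P 2 (clamp (1 / 2)) (toBoundary 2 (n + 1))).toReal) :
    T2_Planar := by
  have key := pc_eq_half_and_theta_pc_eq_zero (theta 2) hmono hP1 hone
    (fun n => (P 2 (clamp (1 / 2)) (toBoundary 2 n)).toReal) hcross (by
    intro hgt
    have hgt' : ((clamp (1 / 2) : unitInterval) : ℝ) < pc 2 := by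
      rw [coe_clamp_half]
      simpa [pc, pcSet] using hgt
    obtain ⟨c, hc, hdec⟩ := hP5 (clamp (1 / 2)) hgt'
    exact ⟨c, hc, fun n hn => hdec n hn⟩)
  refine ⟨?_, ?_⟩
  · show theta 2 (pc 2) = 0
    exact key.2
  · show pc 2 = 1 / 2
    exact key.1

end Summit.Ventures.PercRepro0.PlanarT2
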